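import Literature.MathematicalPhysics.QuantumFieldTheory.Balaban1983to89.Node00.Record11

/-!
# `Balaban1983to89.B16RLeafRecord11` — YM-DAG node N13 · the 𝐑-LEAF OF RECORD AT STAGE 11, `ROpLeaf (VOfRecord₁₁ θ p)`
# ([Balaban1988Convergent] p. 244 ∕ Thm 2 p. 263: «𝐑𝐓ρ_k has the §2 form at k+1»; [Balaban1989LargeFieldII] Thm 1 p. 355: what [B16] delivers),
# UNFOLDED ONE LEVEL FURTHER — to the (0.3) [Balaban1989LargeFieldI] 𝐑-FACTOR of def-R's `rstepOfSel` — with: the identity-selector branch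
# INHABITED (first inhabitation theorem of the leaf at a V of record), the general-selector socket, and the off-range CENSUS in kernel form

statement-level bookkeeping over published theorems with citation tags; kernel-checked compositions of tree theorems;
nothing here is a claim about the Yang–Mills mass gap.

Cell `pub-ymgap` (HUMAN RULING D-0062, Track A), DAG node N13, seat `pub-ymgap-dag-n13-c` (R134 fan-out, strategy s1), director-ym row «`ROpLeaf V`
INHABITATION over the V OF RECORD now available: `VOfRecord₁₁`, `rOpLeaf_VOfRecord₁₁_iff` (`Node00/Record11` :417)».  [III] = [Balaban1988Convergent],
[IV] = [Balaban1989LargeFieldI], [B16] = [Balaban1989LargeFieldII].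

WHAT THE LEAF SAYS, AND ONE LEVEL BELOW.  `Node00.rOpLeaf_VOfRecord₁₁_iff`: `ROpLeaf (VOfRecord₁₁ F N θ p) ↔ ∀ k < K, TLaw₁₁ θ p k → SLaw₁₁ θ p (k+1)` —
«if the pre-𝐑 slot family of `𝐓ρ_k` has the 𝐓-image §2 form (`HasSect2FormTAE`, laws `LawsT … k`) then the post-𝐑 slot family of `ρ_{k+1}` has the §2 form
(`HasSect2FormAE`, laws `LawsRT … (k+1)`)», both a.e. on the `χ_{k+1}(s′)`-support, at the SAME background `U_{k+1}(s′)`.  The two slot families differ by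
def-R's 𝐑-step ON SLOTS (`Node00.slotsOfRecord_succ`, `rstepSlotOfRecord`, `rstepOfSel_TexpA`):
`slot_{k+1}(s′)(V) = slotT_{k+1}(s′)(V) · Σ_{a : ppSel a = s′} ∫⌈_{Z′(a)} t_a ∕ ∫⌈_{Z′(a)} t_{s′}`, `t_a = χ_{k+1}(a)·slotT_{k+1}(a)` — (0.3) [IV]
re-indexed by `Z″`; the second factor is THE 𝐑-FACTOR.  Hence:
* §1–§2 (kernel, generic over `rstepOfSel` ∕ at the record): OFF the range of the selector `θ.ppSel p g (k+1)` the post-𝐑 slot VANISHES (empty fibre: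
  the term is ABSENT from `ρ_{k+1}`, as in print, where the sum after 𝐑 runs over the `Z″`); ON an identity selector the post-𝐑 slot EQUALS the pre-𝐑 slot
  on the `χ_{k+1}(s′)`-support, by the support-form proviso `Provisos₁₀.rstep` (`RepData.ProvisosSupp`: where the denominator fibre integral vanishes so
  does the piece; `0·(0∕0) = 0`).
* §3 ★ THE IDENTITY-SELECTOR BRANCH INHABITS THE LEAF (`rOpLeaf_VOfRecord₁₁_of_forall_sel_eq`): if `θ.ppSel p g (k+1) = id` at every `k < K` — the
  levels at which 𝐑 integrates nothing out (no component of `Z_{k+1}` passes the class decision (i)∧(ii) of [IV] p. 177; e.g. every level before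
  `Nmem` steps of history exist) — then `TLaw₁₁ k → SLaw₁₁ (k+1)` with the SAME term values: the laws by p. 262 [III] (`HasSect2FormTAE.toFormAE_succ`,
  the improved new-term decay weakened under the sign conditions), the identity by §2.  HONEST SCOPE: this is the «𝐑 = 1» branch; Bałaban's 𝐑 is not
  the identity in general, and the general case is §4's socket.
* §4 THE GENERAL-SELECTOR SOCKET (`rOpLeaf_VOfRecord₁₁_of_absorb`): the leaf follows from ONE displayed hypothesis — «the 𝐑-factor is ABSORBED into a
  law-abiding §2 presentation at `k+1`»: for the witnessing term values `t` of the 𝐓-image form there are term values `t′` obeying `LawsRT … (k+1)` with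
  `(𝐓_{k+1}(s′) e^{A(t)})·(𝐑-factor) = 𝐓_{k+1}(s′) e^{A(t′)}` a.e. on the support.  In print this is [IV] Prop. 1 (1.1)–(1.2) p. 177 with [B16] §1
  (1.100)–(1.101) pp. 390–391 (localization and exponentiation of the fibre-integral ratios into new boundary terms `𝐁^{(k+1)}`): THE FIRST ESTIMATE OF
  THE 𝐑-HALF NOT IN THE TREE AT THE OBJECTS OF RECORD (located; not asserted).
* §5 ★ CENSUS (kernel): the leaf and `TLaw₁₁ k` FORCE the `SLaw₁₁ (k+1)`-witness slot `𝐓_{k+1}(s′) e^{A(t′ s′)}` to VANISH a.e. on the `χ_{k+1}(s′)`-support at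
  every `s′ ∉ range (θ.ppSel p g (k+1))` (`exists_sect2Slot_ae_eq_zero_of_rOpLeaf`); so under the displayed NON-DEGENERACY «no law-abiding §2-form slot at
  `s′` vanishes a.e. on the χ-support» (print's case: `𝐓_{k+1}(s′)` of a positive operand with `χ(Y, S)` resolving unity, and `χ_{k+1}(s′)` — PINNED,
  `chiSeqOfRecord` — equal to `1` near `V = 1`) the leaf is FALSE whenever a selector misses a sequence (`not_rOpLeaf_VOfRecord₁₁_of_not_mem_range`), every
  selector is ONTO hence a BIJECTION of the finite index (`bijective_ppSel_of_rOpLeaf`), and an IDEMPOTENT selector (`Z ↦ Z″`, `Z″″ = Z″` — the shape of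
  print's) is the IDENTITY (`forall_sel_eq_of_rOpLeaf`); with §3: **at such a record the 𝐑-leaf holds IFF every selector is the identity**
  (`rOpLeaf_VOfRecord₁₁_iff_forall_sel_eq`).

LOCATED TYPING FINDING (for node00-def-T ∕ def-R; class «pin over-demands», NOT a second gap, NOT mathematics; I restate nothing): AS TYPED, the (S)-pin
`S218OfRecord₁₁` (through `HasSect2FormWithAE`) demands the §2 identity at EVERY admissible sequence of length `k+1` on its χ-support, while def-R's
`rstepOfSel` (faithfully to (0.3)) gives the sequences off the selector's range the slot `0`.  So a genuine (non-surjective, idempotent) 𝐑-step is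
incompatible with the leaf at any non-degenerate record whose 𝐓-image has the §2 form at some level.  Minimal repair C′ (their call): demand the identity
at length `j ≥ 1` only for `s ∈ Set.range (θ.ppSel p g j)` (the sequences PRESENT after 𝐑) — then the general case is exactly §4's socket.

BY NAME and UNCHANGED: `Node00.Record11` (`Stage11Params`, `.Provisos₁₁`, `.Admissible`, `VOfRecord₁₁`, `rOpLeaf_VOfRecord₁₁_iff`, `SLaw₁₁`∕`TLaw₁₁`,
`sLaw₁₁_iff`∕`tLaw₁₁_iff`, `HasSect2FormAE`∕`TAE`∕`WithAE`, `HasSect2FormTAE.toFormAE_succ`, `settingOfRecord₁₁`, `UbgOfRecord₁₁`, `upOfRecord₅C`,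
`rOperation_upOfRecord₅C_stage11_iff`), `Node00.Record10` (`Provisos₁₀.rstep`, `gOfRecord₁₀`, `EOfRecord₁₀`), `Node00.RepTowerOfRecord` (`slotsOfRecord_succ`,
`slotsTOfRecord`), `Node00.RStepSlotOfRecord` (`rstepSlotOfRecord`, `rstepSlot`, `sliceOfRecord`), `Node00.RStepRepr218` (`rstepOfSel`, `rstepOfSel_TexpA`,
`rratio`, `rterm`), `Node00.LargeFieldTowerOfRecord` (`fibOfSeq`, `PpSelOfRecord`, `toRepData_towerRepOfRecord_eq`), `B15.BasicStep.fibreIntegral`,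
`B15RopTotal.RepData.ProvisosSupp`, `Node00.Sect2FormOfRecord` (`sect2Slot`, `Sect2.LawsT`∕`LawsRT`, `Sect2.UniversalE`), `DagBinding.leavesP`.
INSTANCE NOTE: `rstepSlot` bakes the classical `DecidableEq (PBond …)` instance (its import cone has no global one), `Record11`'s cone the global
`instDecidableEqPBond`; §1's generic lemmas take the instance as an implicit binder (unified, not synthesised) and §2 bridges the support proviso by
`convert` (instances are subsingletons).

HONEST FRAMING.  Count-neutral kernel bookkeeping (finite sums, one `filter_upwards`, `Finite.injective_iff_surjective`); 0 `def`, 0 `sorry`, no `instance`,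
no `notation`, standard axioms.  Nothing of Bałaban's is asserted: not Theorem 1 [B16], not (1.1)–(1.2) [IV], not (1.100)–(1.101), not the provisos, no
estimate; the sign conditions `0 ≤ κ, E₀, B₀`, `0 ≤ g_{k+1}` and the non-degeneracy of §5 are DISPLAYED hypotheses.  N13 is NOT discharged by this file.
One finite four-torus programme at fixed `ε`; nothing continuum ∕ ℝ⁴ ∕ OS ∕ mass-gap ∕ Clay.
Sources: T. Bałaban, CMP **119** (1988) 243–285 [III] p. 244, (2.18) p. 257, (2.21)–(2.23) p. 258, Thm 1 p. 262, Thm 2 p. 263, remark p. 262, (3.24)–(3.25)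
p. 270; CMP **122** (1989) 175–202 [IV] (0.2)–(0.4) p. 176, (i)–(ii) p. 177, Prop. 1 (1.1)–(1.2) p. 177; CMP **122** (1989) 355–392 [B16] Thm 1 p. 355,
(1.100)–(1.101) pp. 390–391.

v1.1 (same seat; APPEND-ONLY — every v1.0 declaration byte-identical): §6 = node00-def-T's census ONE LEVEL UP in kernel form (the 𝐓-slot of every extension
of an absent sequence is literally `0`, so under 𝐓-side non-degeneracy `TLaw₁₁ (j+1)` forces `ppSel (j+1)` onto and the leaf's conjuncts at genuine 𝐑-levels hold
vacuously — WORD-n13c, pub-ymgap INBOX l.12212; landed with v1.0); §7 THE 𝐑-STEP NEVER DECREASES A PRESENT SLOT: on a fixed point `s′` of the selector the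
(0.3) 𝐑-factor is `≥ 1` on the `χ_{k+1}(s′)`-support (`le_rstepOfSel_TexpA_of_sel_self`, `slotsT_le_slots_succ_of_sel_self`, `…_of_mem_range_of_idem`) — the
positivity clause of [IV] p. 176 read on the support; what [B16] Thm 1 absorbs has non-negative logarithm there.
-/

noncomputable section

open MeasureTheory
open scoped BigOperators Matrix.Norms.L2Operator

namespace Literature.MathematicalPhysics.QuantumFieldTheory.Balaban1983to89.B16RLeafRecord11

open Literature.MathematicalPhysics.QuantumFieldTheory.Balaban1983to89
open T4Continuum Node00 B14.Eq218Concrete DagBinding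

/-! ## §1  The (0.3) 𝐑-factor of `rstepOfSel`: empty fibre, identity fibre (generic) -/

section RStep

variable {P : Params} {G : Type*} [GaugeGroup G] [MeasurableSpace G] [HaarData G] {j : ℕ}

open Classical in
/-- **OFF THE RANGE OF THE SELECTOR THE 𝐑-STEPPED SLOT VANISHES**: `(𝐓e^A)′(a′) = (𝐓e^A)(a′)·Σ_{a : sel a = a′}(…)` is an EMPTY sum when no `a` selects `a′` —
the term `a′` is ABSENT from `𝐑ρ = Σ_{Z″} …` ((0.3) re-indexed by `Z″`).  The `DecidableEq (PBond …)` instance is an implicit binder (unified with the caller's).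
[cite: Balaban1989LargeFieldI, (0.3) p.176] -/
theorem rstepOfSel_TexpA_of_not_mem_range {hP : DecidableEq (PBond P j)} (r : Step.Repr218 P G j) (sel : r.Adm → r.Adm)
    (fib : r.Adm → Finset (PBond P j)) (a' : r.Adm) (ha' : a' ∉ Set.range sel) (V : GaugeField P j G) :
    (rstepOfSel r sel fib).TexpA a' V = 0 := by
  rw [rstepOfSel_TexpA]
  have : Finset.univ.filter (fun a => sel a = a') = ∅ :=
    Finset.filter_eq_empty_iff.2 fun a _ h => ha' ⟨a, h⟩
  rw [this, Finset.sum_empty, mul_zero]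

open Classical in
/-- **ON THE IDENTITY SELECTOR THE 𝐑-STEPPED SLOT IS UNCHANGED ON THE χ-SUPPORT**: with `sel = id` the fibre of `a′` is `{a′}` and the 𝐑-factor is
`∫⌈_{Z′} t_{a′} ∕ ∫⌈_{Z′} t_{a′}` — `1` where the fibre integral is nonzero; where it vanishes, the support-form proviso of p. 176 («the denominators are
positive» READ ON THE SUPPORT: `∫⌈ t_{a′} = 0 ⇒ t_{a′} = 0`) and `χ(a′)(V) ≠ 0` give `(𝐓e^A)(a′)(V) = 0`, and `0·(0∕0) = 0`. [cite: Balaban1989LargeFieldI, (0.3) p.176] -/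
theorem rstepOfSel_TexpA_of_forall_sel_eq {hP : DecidableEq (PBond P j)} (r : Step.Repr218 P G j) (sel : r.Adm → r.Adm)
    (hsel : ∀ a, sel a = a) (fib : r.Adm → Finset (PBond P j)) (a' : r.Adm) (V : GaugeField P j G)
    (hsupp : B15.BasicStep.fibreIntegral (fib a') (rterm r a') V = 0 → rterm r a' V = 0) (hχ : r.χ a' V ≠ 0) :
    (rstepOfSel r sel fib).TexpA a' V = r.TexpA a' V := by
  rw [rstepOfSel_TexpA]
  have hf : Finset.univ.filter (fun a => sel a = a') = {a'} := by
    ext a; simp [hsel]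
  rw [hf, Finset.sum_singleton]
  by_cases h0 : B15.BasicStep.fibreIntegral (fib a') (rterm r a') V = 0
  · have hT : r.TexpA a' V = 0 := by
      rcases mul_eq_zero.1 (hsupp h0) with h | h
      · exact absurd h hχ
      · exact h
    rw [hT, zero_mul]
  · rw [rratio, div_self h0, mul_one]

/-- **A SURJECTIVE IDEMPOTENT SELF-MAP IS THE IDENTITY** (the shape of print's `Z ↦ Z″`: `Z″″ = Z″`; used in §5). [cite: Balaban1989LargeFieldI, (0.3) p.176, p.177 (bookkeeping)] -/
theorem forall_eq_of_surjective_of_idem {α : Type*} {sel : α → α} (hsurj : Function.Surjective sel) (hidem : ∀ a, sel (sel a) = sel a) (a : α) :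
    sel a = a := by
  obtain ⟨b, rfl⟩ := hsurj a
  exact hidem b

end RStep

/-! ## §2  At def-R's slot operation of record and at the Stage-11 record: the post-𝐑 slot off range ∕ on an identity selector -/

variable (F : T4Family) (N : ℕ) [NeZero N]

section SlotOp

variable {F N} (ν : Stage7Numerics) (τ : TowerNumerics)

/-- `R` of record AS A SLOT OPERATION kills every slot off the range of the selector (ARBITRARY slot family `f`). [cite: Balaban1989LargeFieldI, (0.3) p.176] -/
theorem rstepSlotOfRecord_of_not_mem_range (ppSel : PpSelOfRecord F ν τ.M) (p : B12.RunParams) (g : ℕ → ℝ) (k : ℕ)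
    (f : TexpASlot F N ν τ.M p g k) (s' : SeqOfRecord F ν τ.M g p.K k) (hs' : s' ∉ Set.range (ppSel p g k))
    (V : GaugeField (F.P p.K) k (SU N)) :
    rstepSlotOfRecord F N ν τ ppSel p g k f s' V = 0 := by
  unfold rstepSlotOfRecord rstepSlot
  exact rstepOfSel_TexpA_of_not_mem_range (sliceOfRecord F N ν τ.M p g k f) (ppSel p g k) (fibOfSeq F ν τ p g k) s' hs' V

/-- `R` of record as a slot operation with an IDENTITY selector leaves the slot unchanged on the `χ_k(s′)`-support, under the support-form proviso at `s′`
(ARBITRARY slot family `f`; the proviso is stated with the caller's `DecidableEq (PBond …)` instance and bridged to `rstepSlot`'s by subsingleton-`convert`).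
[cite: Balaban1989LargeFieldI, (0.3) p.176] -/
theorem rstepSlotOfRecord_of_forall_sel_eq (ppSel : PpSelOfRecord F ν τ.M) (p : B12.RunParams) (g : ℕ → ℝ) (k : ℕ)
    (hsel : ∀ a, ppSel p g k a = a)
    (f : TexpASlot F N ν τ.M p g k) (s' : SeqOfRecord F ν τ.M g p.K k) (V : GaugeField (F.P p.K) k (SU N))
    (hsupp : B15.BasicStep.fibreIntegral (fibOfSeq F ν τ p g k s')
        (fun U => chiSeqOfRecord F N ν τ.M g p.K k s' U * f s' U) V = 0 →
      chiSeqOfRecord F N ν τ.M g p.K k s' V * f s' V = 0)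
    (hχ : chiSeqOfRecord F N ν τ.M g p.K k s' V ≠ 0) :
    rstepSlotOfRecord F N ν τ ppSel p g k f s' V = f s' V := by
  unfold rstepSlotOfRecord rstepSlot
  refine rstepOfSel_TexpA_of_forall_sel_eq (sliceOfRecord F N ν τ.M p g k f) (ppSel p g k) hsel (fibOfSeq F ν τ p g k) s' V
    ?_ hχ
  intro h0
  apply hsupp
  convert h0 using 2
  rfl

end SlotOp

section AtRecordSlots

variable (θ : Stage11Params F N) (p : B12.RunParams)

/-- **AT THE STAGE-11 RECORD, OFF THE RANGE OF `θ.ppSel p g (k+1)` THE POST-𝐑 SLOT OF `ρ_{k+1}` VANISHES IDENTICALLY** (`slotsOfRecord_succ` + §1).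
[cite: Balaban1989LargeFieldI, (0.3) p.176; Balaban1988Convergent, (2.18) p.257] -/
theorem slotsOfRecord_succ_eq_zero_of_not_mem_range (k : ℕ)
    (s' : SeqOfRecord F θ.ν θ.τ9.M (gOfRecord₁₀ F N θ.toStage9Params p) p.K (k + 1))
    (hs' : s' ∉ Set.range (θ.ppSel p (gOfRecord₁₀ F N θ.toStage9Params p) (k + 1))) (V : GaugeField (F.P p.K) (k + 1) (SU N)) :
    slotsOfRecord F N θ.ν θ.τ9 (EOfRecord₁₀ F N θ.toStage9Params) (wOfRecord₉ F N θ.toStage9Params) θ.ppSel p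
        (gOfRecord₁₀ F N θ.toStage9Params p) (k + 1) s' V = 0 := by
  rw [slotsOfRecord_succ]
  exact rstepSlotOfRecord_of_not_mem_range θ.ν θ.τ9 θ.ppSel p _ (k + 1) _ s' hs' V

/-- **AT THE STAGE-11 RECORD WITH AN IDENTITY SELECTOR AT LEVEL `k+1`, THE POST-𝐑 SLOT OF `ρ_{k+1}` IS THE PRE-𝐑 SLOT OF `𝐓ρ_k` ON THE `χ_{k+1}(s′)`-SUPPORT**,
under the provisos (`Provisos₁₁.base.rstep`: def-R's (0.3) provisos of the pre-𝐑 tower in support form). [cite: Balaban1989LargeFieldI, (0.3) p.176; Balaban1988Convergent, (3.24)–(3.25) p.270] -/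
theorem slotsOfRecord_succ_eq_slotsT_of_forall_sel_eq (h : θ.Provisos₁₁) (k : ℕ) (hk : k < p.K)
    (hsel : ∀ a, θ.ppSel p (gOfRecord₁₀ F N θ.toStage9Params p) (k + 1) a = a)
    (s' : SeqOfRecord F θ.ν θ.τ9.M (gOfRecord₁₀ F N θ.toStage9Params p) p.K (k + 1)) (V : GaugeField (F.P p.K) (k + 1) (SU N))
    (hχ : chiSeqOfRecord F N θ.ν θ.τ9.M (gOfRecord₁₀ F N θ.toStage9Params p) p.K (k + 1) s' V ≠ 0) :
    slotsOfRecord F N θ.ν θ.τ9 (EOfRecord₁₀ F N θ.toStage9Params) (wOfRecord₉ F N θ.toStage9Params) θ.ppSel p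
        (gOfRecord₁₀ F N θ.toStage9Params p) (k + 1) s' V
      = slotsTOfRecord F N θ.ν θ.τ9 (EOfRecord₁₀ F N θ.toStage9Params) (wOfRecord₉ F N θ.toStage9Params) θ.ppSel p
          (gOfRecord₁₀ F N θ.toStage9Params p) (k + 1) s' V := by
  rw [slotsOfRecord_succ]
  refine rstepSlotOfRecord_of_forall_sel_eq θ.ν θ.τ9 θ.ppSel p _ (k + 1) hsel _ s' V ?_ hχ
  have H := (h.base.rstep p k hk).2.2.2 s' V
  change B15.BasicStep.fibreIntegral (fibOfSeq F θ.ν θ.τ9 p (gOfRecord₁₀ F N θ.toStage9Params p) (k + 1) s')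
      (rterm (repr218OfRecord F N θ.ν θ.τ9.M (slotsTOfRecord F N θ.ν θ.τ9 (EOfRecord₁₀ F N θ.toStage9Params)
        (wOfRecord₉ F N θ.toStage9Params) θ.ppSel) p (gOfRecord₁₀ F N θ.toStage9Params p) (k + 1))
        (θ.ppSel p (gOfRecord₁₀ F N θ.toStage9Params p) (k + 1) s')) V = 0 →
      rterm (repr218OfRecord F N θ.ν θ.τ9.M (slotsTOfRecord F N θ.ν θ.τ9 (EOfRecord₁₀ F N θ.toStage9Params)
        (wOfRecord₉ F N θ.toStage9Params) θ.ppSel) p (gOfRecord₁₀ F N θ.toStage9Params p) (k + 1)) s' V = 0 at H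
  rw [hsel] at H
  exact H

end AtRecordSlots

/-! ## §3  ★ The identity-selector branch INHABITS the leaf -/

section IdentityBranch

variable (θ : Stage11Params F N) (p : B12.RunParams)

/-- **`TLaw₁₁ k → SLaw₁₁ (k+1)` ON THE IDENTITY-SELECTOR BRANCH**: if `θ.ppSel p g (k+1) = id` then the 𝐓-image §2 form of `𝐓ρ_k`'s slots gives the §2 form
of `ρ_{k+1}`'s slots at index `k+1` with the SAME term values and constants — the laws by p. 262 [III] (`HasSect2FormTAE.toFormAE_succ`, under the sign
conditions `0 ≤ β` (admissibility), `0 ≤ κ, E₀, B₀`, `0 ≤ g_{k+1}`, displayed), the a.e. identity transported along `slot_{k+1}(s′) = slotT_{k+1}(s′)` on the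
`χ_{k+1}(s′)`-support (§2).  HONEST SCOPE: the branch where 𝐑 integrates nothing out. [cite: Balaban1988Convergent, §2 p.262, Thm 2 p.263, (3.24)–(3.25) p.270; Balaban1989LargeFieldI, (0.3) p.176] -/
theorem sLaw₁₁_succ_of_tLaw₁₁_of_forall_sel_eq (h : θ.Provisos₁₁) (hθ : θ.Admissible) (hκ : 0 ≤ θ.s2.lf.κ) (hE₀ : 0 ≤ θ.s2.lf.E₀)
    (hB₀ : 0 ≤ θ.s2.lf.B₀) (k : ℕ) (hk : k < p.K) (hg : 0 ≤ gOfRecord₁₀ F N θ.toStage9Params p (k + 1))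
    (hsel : ∀ a, θ.ppSel p (gOfRecord₁₀ F N θ.toStage9Params p) (k + 1) a = a) (hT : TLaw₁₁ F N θ p k) :
    SLaw₁₁ F N θ p (k + 1) := by
  rw [sLaw₁₁_iff]
  have hA := ((tLaw₁₁_iff F N θ p k).mp hT).toFormAE_succ hθ.pos.2.1 hκ hE₀ hB₀ hg
  obtain ⟨t, Ek, hu, hs⟩ := hA
  refine ⟨t, Ek, hu, fun s => ⟨(hs s).1, ?_⟩⟩
  filter_upwards [(hs s).2] with V hV hχ
  rw [slotsOfRecord_succ_eq_slotsT_of_forall_sel_eq F N θ p h k hk hsel s V hχ]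
  exact hV hχ

/-- **★ THE IDENTITY-SELECTOR BRANCH INHABITS THE 𝐑-LEAF OF RECORD AT STAGE 11**: if at every level `k < K` the selector `θ.ppSel p g (k+1)` is the identity,
then — under the provisos, admissibility, the displayed sign conditions and `0 ≤ g_{k+1}` — `ROpLeaf (VOfRecord₁₁ F N θ p)`.  The FIRST inhabitation theorem of
the leaf at a V of record; its honest scope is the «𝐑 = 1» branch (no component of any `Z_{k+1}` is integrated out), the general case being §4's socket.
[cite: Balaban1988Convergent, p.244, Thm 2 p.263, §2 p.262; Balaban1989LargeFieldI, (0.3) p.176; Balaban1989LargeFieldII, Thm 1 p.355 (what the general case needs)] -/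
theorem rOpLeaf_VOfRecord₁₁_of_forall_sel_eq (h : θ.Provisos₁₁) (hθ : θ.Admissible) (hκ : 0 ≤ θ.s2.lf.κ) (hE₀ : 0 ≤ θ.s2.lf.E₀)
    (hB₀ : 0 ≤ θ.s2.lf.B₀) (hg : ∀ k, k < p.K → 0 ≤ gOfRecord₁₀ F N θ.toStage9Params p (k + 1))
    (hsel : ∀ k, k < p.K → ∀ a, θ.ppSel p (gOfRecord₁₀ F N θ.toStage9Params p) (k + 1) a = a) :
    ROpLeaf (VOfRecord₁₁ F N θ p) := by
  rw [rOpLeaf_VOfRecord₁₁_iff]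
  intro k hk hT
  exact sLaw₁₁_succ_of_tLaw₁₁_of_forall_sel_eq F N θ p h hθ hκ hE₀ hB₀ k hk (hg k hk) (hsel k hk) hT

/-- The same with `0 ≤ g_{k+1}` DISCHARGED by the interval hypothesis on the generated flow (`(genFlow β₁₀ g₀).InInterval γ K`: `0 < g_k ≤ γ`, `k ≤ K` — the
form N13's closers carry). [cite: Balaban1989LargeFieldII, Thm 1 p.355; Balaban1987RG1, (0.17)–(0.20) pp.255–256] -/
theorem rOpLeaf_VOfRecord₁₁_of_forall_sel_eq_of_inInterval (h : θ.Provisos₁₁) (hθ : θ.Admissible) (hκ : 0 ≤ θ.s2.lf.κ) (hE₀ : 0 ≤ θ.s2.lf.E₀)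
    (hB₀ : 0 ≤ θ.s2.lf.B₀) {γ : ℝ} (hsc : (FlowStepRuns.genFlow (betaOfRecord₁₀ F N θ.toStage9Params) p.g0).InInterval γ p.K)
    (hsel : ∀ k, k < p.K → ∀ a, θ.ppSel p (gOfRecord₁₀ F N θ.toStage9Params p) (k + 1) a = a) :
    ROpLeaf (VOfRecord₁₁ F N θ p) :=
  rOpLeaf_VOfRecord₁₁_of_forall_sel_eq F N θ p h hθ hκ hE₀ hB₀ (fun k hk => (hsc (k + 1) hk).1.le) hsel

/-- **World form for the consumers of the leaf** (N11 ∕ N13 ∕ N24 knits read `(leavesP w P).rOperation` at a world bound over the Stage-11 view): on the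
identity-selector branch the run's `rOperation` leaf holds. [cite: Balaban1988Convergent, p.244; Balaban1989LargeFieldII, Thm 1 p.355 (bookkeeping)] -/
theorem rOperation_leavesP_of_forall_sel_eq (w : WorldP) (hup : w.up p = upOfRecord₅C F N (θ.toStage5₁₁ F N) p) (h : θ.Provisos₁₁) (hθ : θ.Admissible)
    (hκ : 0 ≤ θ.s2.lf.κ) (hE₀ : 0 ≤ θ.s2.lf.E₀) (hB₀ : 0 ≤ θ.s2.lf.B₀) (hg : ∀ k, k < p.K → 0 ≤ gOfRecord₁₀ F N θ.toStage9Params p (k + 1))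
    (hsel : ∀ k, k < p.K → ∀ a, θ.ppSel p (gOfRecord₁₀ F N θ.toStage9Params p) (k + 1) a = a) :
    (leavesP w p).rOperation := by
  show (w.up p).rOperation
  rw [hup, rOperation_upOfRecord₅C_stage11_iff]
  exact (rOpLeaf_VOfRecord₁₁_iff F N θ p).mp (rOpLeaf_VOfRecord₁₁_of_forall_sel_eq F N θ p h hθ hκ hE₀ hB₀ hg hsel)

end IdentityBranch

/-! ## §4  The general-selector socket: the 𝐑-factor ABSORBED into a §2 presentation ([IV] Prop. 1 + [B16] (1.100)–(1.101) at the objects of record) -/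

section Socket

variable (θ : Stage11Params F N) (p : B12.RunParams)

/-- **`TLaw₁₁ k → SLaw₁₁ (k+1)` FROM THE ABSORPTION OF THE 𝐑-FACTOR** (general selector): if for the term values `t, E_k` witnessing the 𝐓-image form of
`𝐓ρ_k`'s slots there are term values `t′, E′` — universal in 𝐄, obeying the inductive assumptions `LawsRT … (k+1)` — with
`slot_{k+1}(s′) = 𝐓_{k+1}(s′) e^{A(t′ s′)}` a.e. on the `χ_{k+1}(s′)`-support GIVEN `slotT_{k+1}(s′) = 𝐓_{k+1}(s′) e^{A(t s′)}` there (i.e. the 𝐑-factor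
`slot_{k+1}(s′) ∕ slotT_{k+1}(s′)` of §2 is absorbed into new terms), then `SLaw₁₁ θ p (k+1)`.  The displayed hypothesis is [IV] Prop. 1 (1.1)–(1.2) with
[B16] (1.100)–(1.101) READ AT THE OBJECTS OF RECORD — not in the tree at the record; NOT asserted.
[cite: Balaban1989LargeFieldI, Prop. 1 (1.1)–(1.2) p.177; Balaban1989LargeFieldII, Thm 1 p.355, (1.100)–(1.101) pp.390–391; Balaban1988Convergent, Thm 2 p.263] -/
theorem sLaw₁₁_succ_of_tLaw₁₁_of_absorb (k : ℕ) (hT : TLaw₁₁ F N θ p k)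
    (habs : ∀ (t : SeqOfRecord F θ.ν θ.τ9.M (gOfRecord₁₀ F N θ.toStage9Params p) p.K (k + 1) → Sect2.TermValues (F.P p.K) (MatA N) (FluctV N) θ.τ9.M)
      (Ek : SeqOfRecord F θ.ν θ.τ9.M (gOfRecord₁₀ F N θ.toStage9Params p) p.K (k + 1) → ℝ), Sect2.UniversalE t →
      (∀ s, Sect2.LawsT (sect2TowerOfRecord F N (FluctV N) p.K (settingOfRecord₁₁ F N θ p) (θ.Rz p.K) s (t s)) (settingOfRecord₁₁ F N θ p).lf
          (settingOfRecord₁₁ F N θ p).βc k ∧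
        ∀ᵐ V ∂(fieldMeasure (F.P p.K) (k + 1) (SU N)), chiSeqOfRecord F N θ.ν θ.τ9.M (gOfRecord₁₀ F N θ.toStage9Params p) p.K (k + 1) s V ≠ 0 →
          slotsTOfRecord F N θ.ν θ.τ9 (EOfRecord₁₀ F N θ.toStage9Params) (wOfRecord₉ F N θ.toStage9Params) θ.ppSel p
              (gOfRecord₁₀ F N θ.toStage9Params p) (k + 1) s V
            = sect2Slot F N (FluctV N) p.K (settingOfRecord₁₁ F N θ p) (θ.Rz p.K) (θ.Wt p.K) s (t s) (Ek s) (UbgOfRecord₁₁ F N θ p (k + 1) s) V) →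
      ∃ (t' : SeqOfRecord F θ.ν θ.τ9.M (gOfRecord₁₀ F N θ.toStage9Params p) p.K (k + 1) → Sect2.TermValues (F.P p.K) (MatA N) (FluctV N) θ.τ9.M)
        (Ek' : SeqOfRecord F θ.ν θ.τ9.M (gOfRecord₁₀ F N θ.toStage9Params p) p.K (k + 1) → ℝ), Sect2.UniversalE t' ∧
        ∀ s, Sect2.LawsRT (sect2TowerOfRecord F N (FluctV N) p.K (settingOfRecord₁₁ F N θ p) (θ.Rz p.K) s (t' s)) (settingOfRecord₁₁ F N θ p).lf
            (k + 1) ∧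
          ∀ᵐ V ∂(fieldMeasure (F.P p.K) (k + 1) (SU N)), chiSeqOfRecord F N θ.ν θ.τ9.M (gOfRecord₁₀ F N θ.toStage9Params p) p.K (k + 1) s V ≠ 0 →
            slotsOfRecord F N θ.ν θ.τ9 (EOfRecord₁₀ F N θ.toStage9Params) (wOfRecord₉ F N θ.toStage9Params) θ.ppSel p
                (gOfRecord₁₀ F N θ.toStage9Params p) (k + 1) s V
              = sect2Slot F N (FluctV N) p.K (settingOfRecord₁₁ F N θ p) (θ.Rz p.K) (θ.Wt p.K) s (t' s) (Ek' s) (UbgOfRecord₁₁ F N θ p (k + 1) s) V) :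
    SLaw₁₁ F N θ p (k + 1) := by
  rw [sLaw₁₁_iff]
  obtain ⟨t, Ek, hu, hs⟩ := (tLaw₁₁_iff F N θ p k).mp hT
  obtain ⟨t', Ek', hu', hs'⟩ := habs t Ek hu hs
  exact ⟨t', Ek', hu', hs'⟩

/-- **THE GENERAL-SELECTOR SOCKET FOR THE LEAF**: the absorption hypothesis of `sLaw₁₁_succ_of_tLaw₁₁_of_absorb` at every level `k < K` gives
`ROpLeaf (VOfRecord₁₁ F N θ p)` — the DISCHARGE-SHAPED statement of the 𝐑-half of N13 at Stage 11: its one displayed hypothesis is [B16] Theorem 1's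
𝐑-construction read at the objects of record (NOT asserted; the first estimate of the 𝐑-half missing from the tree at the record).
[cite: Balaban1989LargeFieldII, Thm 1 p.355, (1.100)–(1.101) pp.390–391; Balaban1989LargeFieldI, Prop. 1 (1.1)–(1.2) p.177; Balaban1988Convergent, p.244, Thm 2 p.263] -/
theorem rOpLeaf_VOfRecord₁₁_of_absorb
    (habs : ∀ k, k < p.K →
      ∀ (t : SeqOfRecord F θ.ν θ.τ9.M (gOfRecord₁₀ F N θ.toStage9Params p) p.K (k + 1) → Sect2.TermValues (F.P p.K) (MatA N) (FluctV N) θ.τ9.M)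
      (Ek : SeqOfRecord F θ.ν θ.τ9.M (gOfRecord₁₀ F N θ.toStage9Params p) p.K (k + 1) → ℝ), Sect2.UniversalE t →
      (∀ s, Sect2.LawsT (sect2TowerOfRecord F N (FluctV N) p.K (settingOfRecord₁₁ F N θ p) (θ.Rz p.K) s (t s)) (settingOfRecord₁₁ F N θ p).lf
          (settingOfRecord₁₁ F N θ p).βc k ∧
        ∀ᵐ V ∂(fieldMeasure (F.P p.K) (k + 1) (SU N)), chiSeqOfRecord F N θ.ν θ.τ9.M (gOfRecord₁₀ F N θ.toStage9Params p) p.K (k + 1) s V ≠ 0 →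
          slotsTOfRecord F N θ.ν θ.τ9 (EOfRecord₁₀ F N θ.toStage9Params) (wOfRecord₉ F N θ.toStage9Params) θ.ppSel p
              (gOfRecord₁₀ F N θ.toStage9Params p) (k + 1) s V
            = sect2Slot F N (FluctV N) p.K (settingOfRecord₁₁ F N θ p) (θ.Rz p.K) (θ.Wt p.K) s (t s) (Ek s) (UbgOfRecord₁₁ F N θ p (k + 1) s) V) →
      ∃ (t' : SeqOfRecord F θ.ν θ.τ9.M (gOfRecord₁₀ F N θ.toStage9Params p) p.K (k + 1) → Sect2.TermValues (F.P p.K) (MatA N) (FluctV N) θ.τ9.M)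
        (Ek' : SeqOfRecord F θ.ν θ.τ9.M (gOfRecord₁₀ F N θ.toStage9Params p) p.K (k + 1) → ℝ), Sect2.UniversalE t' ∧
        ∀ s, Sect2.LawsRT (sect2TowerOfRecord F N (FluctV N) p.K (settingOfRecord₁₁ F N θ p) (θ.Rz p.K) s (t' s)) (settingOfRecord₁₁ F N θ p).lf
            (k + 1) ∧
          ∀ᵐ V ∂(fieldMeasure (F.P p.K) (k + 1) (SU N)), chiSeqOfRecord F N θ.ν θ.τ9.M (gOfRecord₁₀ F N θ.toStage9Params p) p.K (k + 1) s V ≠ 0 →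
            slotsOfRecord F N θ.ν θ.τ9 (EOfRecord₁₀ F N θ.toStage9Params) (wOfRecord₉ F N θ.toStage9Params) θ.ppSel p
                (gOfRecord₁₀ F N θ.toStage9Params p) (k + 1) s V
              = sect2Slot F N (FluctV N) p.K (settingOfRecord₁₁ F N θ p) (θ.Rz p.K) (θ.Wt p.K) s (t' s) (Ek' s) (UbgOfRecord₁₁ F N θ p (k + 1) s) V) :
    ROpLeaf (VOfRecord₁₁ F N θ p) := by
  rw [rOpLeaf_VOfRecord₁₁_iff]
  intro k hk hT
  exact sLaw₁₁_succ_of_tLaw₁₁_of_absorb F N θ p k hT (habs k hk)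

end Socket

/-! ## §5  ★ CENSUS: off-range sequences — the leaf forces vanishing witness slots; non-degeneracy ⇒ every selector is onto, bijective, and (idempotent) the identity -/

section Census

variable (θ : Stage11Params F N) (p : B12.RunParams)

/-- **THE LEAF AND `TLaw₁₁ k` FORCE THE `SLaw₁₁ (k+1)`-WITNESS SLOT TO VANISH a.e. ON THE `χ_{k+1}(s′)`-SUPPORT AT EVERY OFF-RANGE `s′`**: the post-𝐑 slot is `0`
there (§2), and the (S)-pin asks it to equal `𝐓_{k+1}(s′) e^{A(t′ s′)}` a.e. on the support for law-abiding `t′`.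
[cite: Balaban1988Convergent, (2.18) p.257, Thm 2 p.263; Balaban1989LargeFieldI, (0.3) p.176] -/
theorem exists_sect2Slot_ae_eq_zero_of_rOpLeaf (hR : ROpLeaf (VOfRecord₁₁ F N θ p)) (k : ℕ) (hk : k < p.K) (hT : TLaw₁₁ F N θ p k)
    (s' : SeqOfRecord F θ.ν θ.τ9.M (gOfRecord₁₀ F N θ.toStage9Params p) p.K (k + 1))
    (hs' : s' ∉ Set.range (θ.ppSel p (gOfRecord₁₀ F N θ.toStage9Params p) (k + 1))) :
    ∃ (t : SeqOfRecord F θ.ν θ.τ9.M (gOfRecord₁₀ F N θ.toStage9Params p) p.K (k + 1) → Sect2.TermValues (F.P p.K) (MatA N) (FluctV N) θ.τ9.M)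
      (Ek : SeqOfRecord F θ.ν θ.τ9.M (gOfRecord₁₀ F N θ.toStage9Params p) p.K (k + 1) → ℝ), Sect2.UniversalE t ∧
      (∀ s, Sect2.LawsRT (sect2TowerOfRecord F N (FluctV N) p.K (settingOfRecord₁₁ F N θ p) (θ.Rz p.K) s (t s)) (settingOfRecord₁₁ F N θ p).lf (k + 1)) ∧
      ∀ᵐ V ∂(fieldMeasure (F.P p.K) (k + 1) (SU N)), chiSeqOfRecord F N θ.ν θ.τ9.M (gOfRecord₁₀ F N θ.toStage9Params p) p.K (k + 1) s' V ≠ 0 →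
        sect2Slot F N (FluctV N) p.K (settingOfRecord₁₁ F N θ p) (θ.Rz p.K) (θ.Wt p.K) s' (t s') (Ek s') (UbgOfRecord₁₁ F N θ p (k + 1) s') V = 0 := by
  have hS := (rOpLeaf_VOfRecord₁₁_iff F N θ p).mp hR k hk hT
  rw [sLaw₁₁_iff] at hS
  obtain ⟨t, Ek, hu, hs⟩ := hS
  refine ⟨t, Ek, hu, fun s => (hs s).1, ?_⟩
  filter_upwards [(hs s').2] with V hV hχ
  rw [← hV hχ]
  exact slotsOfRecord_succ_eq_zero_of_not_mem_range F N θ p k s' hs' V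

/-- **UNDER NON-DEGENERACY THE LEAF IS FALSE WHENEVER A SELECTOR MISSES A SEQUENCE.**  Displayed non-degeneracy at `s′`: NO law-abiding §2-form slot
`𝐓_{k+1}(s′) e^{A(t)}` vanishes a.e. on the `χ_{k+1}(s′)`-support (print's case: `𝐓_{k+1}(s′)` of a positive operand is positive a.e. — `χ(Y, S)` resolving
unity — and `χ_{k+1}(s′) = 1` near `V = 1`; NOT asserted).  With `TLaw₁₁ k` (Bałaban's 𝐓-theorem at the record; a premise) and `s′ ∉ range (θ.ppSel p g (k+1))`,
`¬ ROpLeaf (VOfRecord₁₁ F N θ p)`. [cite: Balaban1988Convergent, (2.18) p.257, (2.21) p.258, Thm 2 p.263; Balaban1989LargeFieldI, (0.3) p.176 (located census)] -/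
theorem not_rOpLeaf_VOfRecord₁₁_of_not_mem_range (k : ℕ) (hk : k < p.K) (hT : TLaw₁₁ F N θ p k)
    (s' : SeqOfRecord F θ.ν θ.τ9.M (gOfRecord₁₀ F N θ.toStage9Params p) p.K (k + 1))
    (hs' : s' ∉ Set.range (θ.ppSel p (gOfRecord₁₀ F N θ.toStage9Params p) (k + 1)))
    (hnd : ∀ (t : Sect2.TermValues (F.P p.K) (MatA N) (FluctV N) θ.τ9.M) (Ek : ℝ),
      Sect2.LawsRT (sect2TowerOfRecord F N (FluctV N) p.K (settingOfRecord₁₁ F N θ p) (θ.Rz p.K) s' t) (settingOfRecord₁₁ F N θ p).lf (k + 1) →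
      ¬ ∀ᵐ V ∂(fieldMeasure (F.P p.K) (k + 1) (SU N)), chiSeqOfRecord F N θ.ν θ.τ9.M (gOfRecord₁₀ F N θ.toStage9Params p) p.K (k + 1) s' V ≠ 0 →
        sect2Slot F N (FluctV N) p.K (settingOfRecord₁₁ F N θ p) (θ.Rz p.K) (θ.Wt p.K) s' t Ek (UbgOfRecord₁₁ F N θ p (k + 1) s') V = 0) :
    ¬ ROpLeaf (VOfRecord₁₁ F N θ p) := by
  intro hR
  obtain ⟨t, Ek, -, hl, hae⟩ := exists_sect2Slot_ae_eq_zero_of_rOpLeaf F N θ p hR k hk hT s' hs'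
  exact hnd (t s') (Ek s') (hl s') hae

/-- **UNDER NON-DEGENERACY AT EVERY SEQUENCE, THE LEAF FORCES EVERY SELECTOR `θ.ppSel p g (k+1)` (`k < K`, with `TLaw₁₁ k`) TO BE ONTO.**
[cite: Balaban1989LargeFieldI, (0.3) p.176, p.177; Balaban1988Convergent, Thm 2 p.263 (located census)] -/
theorem surjective_ppSel_of_rOpLeaf (hR : ROpLeaf (VOfRecord₁₁ F N θ p)) (k : ℕ) (hk : k < p.K) (hT : TLaw₁₁ F N θ p k)
    (hnd : ∀ (s' : SeqOfRecord F θ.ν θ.τ9.M (gOfRecord₁₀ F N θ.toStage9Params p) p.K (k + 1))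
      (t : Sect2.TermValues (F.P p.K) (MatA N) (FluctV N) θ.τ9.M) (Ek : ℝ),
      Sect2.LawsRT (sect2TowerOfRecord F N (FluctV N) p.K (settingOfRecord₁₁ F N θ p) (θ.Rz p.K) s' t) (settingOfRecord₁₁ F N θ p).lf (k + 1) →
      ¬ ∀ᵐ V ∂(fieldMeasure (F.P p.K) (k + 1) (SU N)), chiSeqOfRecord F N θ.ν θ.τ9.M (gOfRecord₁₀ F N θ.toStage9Params p) p.K (k + 1) s' V ≠ 0 →
        sect2Slot F N (FluctV N) p.K (settingOfRecord₁₁ F N θ p) (θ.Rz p.K) (θ.Wt p.K) s' t Ek (UbgOfRecord₁₁ F N θ p (k + 1) s') V = 0) :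
    Function.Surjective (θ.ppSel p (gOfRecord₁₀ F N θ.toStage9Params p) (k + 1)) := by
  intro s'
  by_contra hs'
  exact not_rOpLeaf_VOfRecord₁₁_of_not_mem_range F N θ p k hk hT s' (by simpa [Set.mem_range] using hs') (hnd s') hR

/-- … hence A BIJECTION of the finite summation index `SeqOfRecord … (k+1)` (`Finite.injective_iff_surjective`).
[cite: Balaban1989LargeFieldI, (0.3) p.176; Balaban1988Convergent, (2.18) p.257 (finite sum; located census)] -/
theorem bijective_ppSel_of_rOpLeaf (hR : ROpLeaf (VOfRecord₁₁ F N θ p)) (k : ℕ) (hk : k < p.K) (hT : TLaw₁₁ F N θ p k)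
    (hnd : ∀ (s' : SeqOfRecord F θ.ν θ.τ9.M (gOfRecord₁₀ F N θ.toStage9Params p) p.K (k + 1))
      (t : Sect2.TermValues (F.P p.K) (MatA N) (FluctV N) θ.τ9.M) (Ek : ℝ),
      Sect2.LawsRT (sect2TowerOfRecord F N (FluctV N) p.K (settingOfRecord₁₁ F N θ p) (θ.Rz p.K) s' t) (settingOfRecord₁₁ F N θ p).lf (k + 1) →
      ¬ ∀ᵐ V ∂(fieldMeasure (F.P p.K) (k + 1) (SU N)), chiSeqOfRecord F N θ.ν θ.τ9.M (gOfRecord₁₀ F N θ.toStage9Params p) p.K (k + 1) s' V ≠ 0 →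
        sect2Slot F N (FluctV N) p.K (settingOfRecord₁₁ F N θ p) (θ.Rz p.K) (θ.Wt p.K) s' t Ek (UbgOfRecord₁₁ F N θ p (k + 1) s') V = 0) :
    Function.Bijective (θ.ppSel p (gOfRecord₁₀ F N θ.toStage9Params p) (k + 1)) := by
  have hsurj := surjective_ppSel_of_rOpLeaf F N θ p hR k hk hT hnd
  exact ⟨Finite.injective_iff_surjective.mpr hsurj, hsurj⟩

/-- **… AND AN IDEMPOTENT SELECTOR IS THEN THE IDENTITY** (`Z ↦ Z″` with `Z″″ = Z″`, the shape of print's selection of «the term ρ(Z″, ·)»): under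
non-degeneracy, `TLaw₁₁ k` and the leaf, `θ.ppSel p g (k+1) = id` — AS TYPED, THE LEAF ADMITS ONLY THE «𝐑 = 1» BRANCH at such a record.
[cite: Balaban1989LargeFieldI, (0.3) p.176, p.177 («the term ρ(Z″, ·)»); Balaban1989LargeFieldII, Thm 1 p.355 (located census)] -/
theorem forall_sel_eq_of_rOpLeaf (hR : ROpLeaf (VOfRecord₁₁ F N θ p)) (k : ℕ) (hk : k < p.K) (hT : TLaw₁₁ F N θ p k)
    (hidem : ∀ a, θ.ppSel p (gOfRecord₁₀ F N θ.toStage9Params p) (k + 1) (θ.ppSel p (gOfRecord₁₀ F N θ.toStage9Params p) (k + 1) a)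
      = θ.ppSel p (gOfRecord₁₀ F N θ.toStage9Params p) (k + 1) a)
    (hnd : ∀ (s' : SeqOfRecord F θ.ν θ.τ9.M (gOfRecord₁₀ F N θ.toStage9Params p) p.K (k + 1))
      (t : Sect2.TermValues (F.P p.K) (MatA N) (FluctV N) θ.τ9.M) (Ek : ℝ),
      Sect2.LawsRT (sect2TowerOfRecord F N (FluctV N) p.K (settingOfRecord₁₁ F N θ p) (θ.Rz p.K) s' t) (settingOfRecord₁₁ F N θ p).lf (k + 1) →
      ¬ ∀ᵐ V ∂(fieldMeasure (F.P p.K) (k + 1) (SU N)), chiSeqOfRecord F N θ.ν θ.τ9.M (gOfRecord₁₀ F N θ.toStage9Params p) p.K (k + 1) s' V ≠ 0 →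
        sect2Slot F N (FluctV N) p.K (settingOfRecord₁₁ F N θ p) (θ.Rz p.K) (θ.Wt p.K) s' t Ek (UbgOfRecord₁₁ F N θ p (k + 1) s') V = 0) :
    ∀ a, θ.ppSel p (gOfRecord₁₀ F N θ.toStage9Params p) (k + 1) a = a :=
  forall_eq_of_surjective_of_idem (surjective_ppSel_of_rOpLeaf F N θ p hR k hk hT hnd) hidem

/-- **★ CHARACTERISATION**: at an admissible Stage-11 record with provisos and the displayed signs, whose 𝐓-images have the §2 form at every level `k < K`
(Bałaban's 𝐓-theorem, a premise), whose selectors are idempotent and whose 𝐓-weights are non-degenerate at every sequence, **the 𝐑-leaf of record holds IFF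
every selector `θ.ppSel p g (k+1)` is the identity** — the located content of the pin (S) as typed.
[cite: Balaban1988Convergent, p.244, Thm 2 p.263; Balaban1989LargeFieldI, (0.3) p.176, Prop. 1 p.177; Balaban1989LargeFieldII, Thm 1 p.355 (located census)] -/
theorem rOpLeaf_VOfRecord₁₁_iff_forall_sel_eq (h : θ.Provisos₁₁) (hθ : θ.Admissible) (hκ : 0 ≤ θ.s2.lf.κ) (hE₀ : 0 ≤ θ.s2.lf.E₀)
    (hB₀ : 0 ≤ θ.s2.lf.B₀) (hg : ∀ k, k < p.K → 0 ≤ gOfRecord₁₀ F N θ.toStage9Params p (k + 1)) (hK : ∀ k, k < p.K → TLaw₁₁ F N θ p k)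
    (hidem : ∀ k, k < p.K → ∀ a,
      θ.ppSel p (gOfRecord₁₀ F N θ.toStage9Params p) (k + 1) (θ.ppSel p (gOfRecord₁₀ F N θ.toStage9Params p) (k + 1) a)
        = θ.ppSel p (gOfRecord₁₀ F N θ.toStage9Params p) (k + 1) a)
    (hnd : ∀ k, k < p.K → ∀ (s' : SeqOfRecord F θ.ν θ.τ9.M (gOfRecord₁₀ F N θ.toStage9Params p) p.K (k + 1))
      (t : Sect2.TermValues (F.P p.K) (MatA N) (FluctV N) θ.τ9.M) (Ek : ℝ),
      Sect2.LawsRT (sect2TowerOfRecord F N (FluctV N) p.K (settingOfRecord₁₁ F N θ p) (θ.Rz p.K) s' t) (settingOfRecord₁₁ F N θ p).lf (k + 1) →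
      ¬ ∀ᵐ V ∂(fieldMeasure (F.P p.K) (k + 1) (SU N)), chiSeqOfRecord F N θ.ν θ.τ9.M (gOfRecord₁₀ F N θ.toStage9Params p) p.K (k + 1) s' V ≠ 0 →
        sect2Slot F N (FluctV N) p.K (settingOfRecord₁₁ F N θ p) (θ.Rz p.K) (θ.Wt p.K) s' t Ek (UbgOfRecord₁₁ F N θ p (k + 1) s') V = 0) :
    ROpLeaf (VOfRecord₁₁ F N θ p) ↔ ∀ k, k < p.K → ∀ a, θ.ppSel p (gOfRecord₁₀ F N θ.toStage9Params p) (k + 1) a = a :=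
  ⟨fun hR k hk => forall_sel_eq_of_rOpLeaf F N θ p hR k hk (hK k hk) (hidem k hk) (hnd k hk),
    fun hsel => rOpLeaf_VOfRecord₁₁_of_forall_sel_eq F N θ p h hθ hκ hE₀ hB₀ hg hsel⟩

end Census

/-! ## §6  ★ CENSUS ONE LEVEL UP (node00-def-T's WORD-n13c): the 𝐓-slot of every extension of an ABSENT sequence vanishes, so `TLaw₁₁ (j+1)` itself forces `ppSel (j+1)` onto -/

section CensusT

variable (θ : Stage11Params F N) (p : B12.RunParams)

/-- **THE PRE-𝐑 SLOT OF `𝐓ρ_{j+1}` AT AN EXTENSION OF AN ABSENT LENGTH-`(j+1)` SEQUENCE IS LITERALLY ZERO**: `slotT_{j+2}(s′) = ∫dU δ(ŪV′⁻¹)[w(s′)·χ_{j+1}(init s′)·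
slot_{j+1}(init s′)]` ((†), `tstepOfRecord_apply`) and `slot_{j+1}(init s′) ≡ 0` off the range of `θ.ppSel p g (j+1)` (§2) — the kernel transport of the zero
density is `h(V′)·∫0 = 0`.  EVERYWHERE, not a.e. [cite: Balaban1988Convergent, (3.1) p.264, (3.24)–(3.25) p.270; Balaban1989LargeFieldI, (0.3) p.176] -/
theorem slotsTOfRecord_succ_succ_eq_zero_of_init_not_mem_range (j : ℕ)
    (s' : SeqOfRecord F θ.ν θ.τ9.M (gOfRecord₁₀ F N θ.toStage9Params p) p.K (j + 2))
    (hs : s'.init ∉ Set.range (θ.ppSel p (gOfRecord₁₀ F N θ.toStage9Params p) (j + 1))) (V' : GaugeField (F.P p.K) (j + 2) (SU N)) :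
    slotsTOfRecord F N θ.ν θ.τ9 (EOfRecord₁₀ F N θ.toStage9Params) (wOfRecord₉ F N θ.toStage9Params) θ.ppSel p
        (gOfRecord₁₀ F N θ.toStage9Params p) (j + 2) s' V' = 0 := by
  rw [slotsTOfRecord_succ, tstepOfRecord_apply]
  have h0 : (fun U => wOfRecord₉ F N θ.toStage9Params p (gOfRecord₁₀ F N θ.toStage9Params p) (j + 1) s' U V' *
      (chiSeqOfRecord F N θ.ν θ.τ9.M (gOfRecord₁₀ F N θ.toStage9Params p) p.K (j + 1) s'.init U *
        slotsOfRecord F N θ.ν θ.τ9 (EOfRecord₁₀ F N θ.toStage9Params) (wOfRecord₉ F N θ.toStage9Params) θ.ppSel p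
          (gOfRecord₁₀ F N θ.toStage9Params p) (j + 1) s'.init U)) = fun _ => 0 := by
    funext U
    rw [slotsOfRecord_succ_eq_zero_of_not_mem_range F N θ p j s'.init hs U, mul_zero, mul_zero]
  rw [h0]
  simp only [transportOfRecord, T4AveragingDisintegration.transportK, T4AveragingDisintegration.kernelTransport, integral_zero, mul_zero]

/-- **`TLaw₁₁ (j+1)` FORCES ITS WITNESS SLOT TO VANISH a.e. ON THE `χ_{j+2}(s′)`-SUPPORT AT EVERY EXTENSION `s′` OF AN ABSENT SEQUENCE** (the 𝐓-image pin
`ScorrLawOfRecord₁₁` over-demands exactly like the (S)-pin, one level up). [cite: Balaban1988Convergent, remark p.262, (3.25) p.270; Balaban1989LargeFieldI, (0.3) p.176 (located census)] -/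
theorem exists_sect2Slot_ae_eq_zero_of_tLaw₁₁_succ (j : ℕ) (hT : TLaw₁₁ F N θ p (j + 1))
    (s' : SeqOfRecord F θ.ν θ.τ9.M (gOfRecord₁₀ F N θ.toStage9Params p) p.K (j + 2))
    (hs : s'.init ∉ Set.range (θ.ppSel p (gOfRecord₁₀ F N θ.toStage9Params p) (j + 1))) :
    ∃ (t : SeqOfRecord F θ.ν θ.τ9.M (gOfRecord₁₀ F N θ.toStage9Params p) p.K (j + 2) → Sect2.TermValues (F.P p.K) (MatA N) (FluctV N) θ.τ9.M)
      (Ek : SeqOfRecord F θ.ν θ.τ9.M (gOfRecord₁₀ F N θ.toStage9Params p) p.K (j + 2) → ℝ), Sect2.UniversalE t ∧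
      (∀ s, Sect2.LawsT (sect2TowerOfRecord F N (FluctV N) p.K (settingOfRecord₁₁ F N θ p) (θ.Rz p.K) s (t s)) (settingOfRecord₁₁ F N θ p).lf
        (settingOfRecord₁₁ F N θ p).βc (j + 1)) ∧
      ∀ᵐ V ∂(fieldMeasure (F.P p.K) (j + 2) (SU N)), chiSeqOfRecord F N θ.ν θ.τ9.M (gOfRecord₁₀ F N θ.toStage9Params p) p.K (j + 2) s' V ≠ 0 →
        sect2Slot F N (FluctV N) p.K (settingOfRecord₁₁ F N θ p) (θ.Rz p.K) (θ.Wt p.K) s' (t s') (Ek s') (UbgOfRecord₁₁ F N θ p (j + 2) s') V = 0 := by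
  obtain ⟨t, Ek, hu, hs'⟩ := (tLaw₁₁_iff F N θ p (j + 1)).mp hT
  refine ⟨t, Ek, hu, fun s => (hs' s).1, ?_⟩
  filter_upwards [(hs' s').2] with V hV hχ
  rw [← hV hχ]
  exact slotsTOfRecord_succ_succ_eq_zero_of_init_not_mem_range F N θ p j s' hs V

/-- **UNDER NON-DEGENERACY (𝐓-side: no `LawsT`-abiding §2-form slot at `s′` vanishes a.e. on the `χ_{j+2}(s′)`-support), `TLaw₁₁ (j+1)` IS FALSE AS SOON AS THE
PREFIX OF `s′` IS ABSENT.** [cite: Balaban1988Convergent, remark p.262, (3.25) p.270; Balaban1989LargeFieldI, (0.3) p.176 (located census)] -/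
theorem not_tLaw₁₁_succ_of_init_not_mem_range (j : ℕ)
    (s' : SeqOfRecord F θ.ν θ.τ9.M (gOfRecord₁₀ F N θ.toStage9Params p) p.K (j + 2))
    (hs : s'.init ∉ Set.range (θ.ppSel p (gOfRecord₁₀ F N θ.toStage9Params p) (j + 1)))
    (hnd : ∀ (t : Sect2.TermValues (F.P p.K) (MatA N) (FluctV N) θ.τ9.M) (Ek : ℝ),
      Sect2.LawsT (sect2TowerOfRecord F N (FluctV N) p.K (settingOfRecord₁₁ F N θ p) (θ.Rz p.K) s' t) (settingOfRecord₁₁ F N θ p).lf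
        (settingOfRecord₁₁ F N θ p).βc (j + 1) →
      ¬ ∀ᵐ V ∂(fieldMeasure (F.P p.K) (j + 2) (SU N)), chiSeqOfRecord F N θ.ν θ.τ9.M (gOfRecord₁₀ F N θ.toStage9Params p) p.K (j + 2) s' V ≠ 0 →
        sect2Slot F N (FluctV N) p.K (settingOfRecord₁₁ F N θ p) (θ.Rz p.K) (θ.Wt p.K) s' t Ek (UbgOfRecord₁₁ F N θ p (j + 2) s') V = 0) :
    ¬ TLaw₁₁ F N θ p (j + 1) := by
  intro hT
  obtain ⟨t, Ek, -, hl, hae⟩ := exists_sect2Slot_ae_eq_zero_of_tLaw₁₁_succ F N θ p j hT s' hs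
  exact hnd (t s') (Ek s') (hl s') hae

/-- Every admissible sequence of record EXTENDS by the empty pair `(Ω_{j+2}, Λ_{j+2}) = (∅, ∅)` (`∅ ∈ 𝐃_{j+2}` of record; the chain conditions are trivial):
`Seq.init` is onto. [cite: Balaban1988Convergent, (2.1) p.254 (bookkeeping)] -/
theorem exists_init_eq (j : ℕ) (s : SeqOfRecord F θ.ν θ.τ9.M (gOfRecord₁₀ F N θ.toStage9Params p) p.K (j + 1)) :
    ∃ s' : SeqOfRecord F θ.ν θ.τ9.M (gOfRecord₁₀ F N θ.toStage9Params p) p.K (j + 2), s'.init = s :=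
  ⟨s.snoc ⟨(∅, ∅), empty_mem_unionsOfCubes _ _, empty_mem_unionsOfCubes _ _, Set.empty_subset _, fun _ => Set.empty_subset _⟩,
    Seq.init_snoc _ _⟩

/-- **UNDER 𝐓-SIDE NON-DEGENERACY AT EVERY LENGTH-`(j+2)` SEQUENCE, `TLaw₁₁ (j+1)` FORCES `θ.ppSel p g (j+1)` TO BE ONTO** (node00-def-T's census one level
up, in kernel form): an absent length-`(j+1)` sequence extends (by the empty pair) to a sequence whose 𝐓-slot is `0`, contradicting the pin.  Hence, AS TYPED,
at a non-degenerate record with a genuine (non-surjective) 𝐑-step at level `j+1` the premise `TLaw₁₁ (j+1)` is FALSE and the leaf's conjunct `k = j+1` holds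
VACUOUSLY — only the conjunct `k = 0` and the levels before the first genuine 𝐑-step bite.
[cite: Balaban1988Convergent, remark p.262, (3.25) p.270; Balaban1989LargeFieldI, (0.3) p.176, p.177 (located census)] -/
theorem surjective_ppSel_of_tLaw₁₁_succ (j : ℕ) (hT : TLaw₁₁ F N θ p (j + 1))
    (hnd : ∀ (s' : SeqOfRecord F θ.ν θ.τ9.M (gOfRecord₁₀ F N θ.toStage9Params p) p.K (j + 2))
      (t : Sect2.TermValues (F.P p.K) (MatA N) (FluctV N) θ.τ9.M) (Ek : ℝ),
      Sect2.LawsT (sect2TowerOfRecord F N (FluctV N) p.K (settingOfRecord₁₁ F N θ p) (θ.Rz p.K) s' t) (settingOfRecord₁₁ F N θ p).lf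
        (settingOfRecord₁₁ F N θ p).βc (j + 1) →
      ¬ ∀ᵐ V ∂(fieldMeasure (F.P p.K) (j + 2) (SU N)), chiSeqOfRecord F N θ.ν θ.τ9.M (gOfRecord₁₀ F N θ.toStage9Params p) p.K (j + 2) s' V ≠ 0 →
        sect2Slot F N (FluctV N) p.K (settingOfRecord₁₁ F N θ p) (θ.Rz p.K) (θ.Wt p.K) s' t Ek (UbgOfRecord₁₁ F N θ p (j + 2) s') V = 0) :
    Function.Surjective (θ.ppSel p (gOfRecord₁₀ F N θ.toStage9Params p) (j + 1)) := by
  intro s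
  by_contra hs
  obtain ⟨s', hs'⟩ := exists_init_eq F N θ p j s
  refine not_tLaw₁₁_succ_of_init_not_mem_range F N θ p j s' ?_ (hnd s') hT
  rw [hs']
  simpa [Set.mem_range] using hs

/-- **THE VACUOUS CONJUNCTS**: under 𝐓-side non-degeneracy, at every level `j+1` whose selector is NOT onto (a genuine 𝐑-step), the leaf's conjunct
`TLaw₁₁ (j+1) → SLaw₁₁ (j+2)` holds FOR THE WRONG REASON (false premise) — the located content of the 𝐓-image pin as typed.
[cite: Balaban1988Convergent, p.244, remark p.262; Balaban1989LargeFieldI, (0.3) p.176 (located census)] -/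
theorem tLaw₁₁_imp_sLaw₁₁_of_not_surjective (j : ℕ)
    (hsel : ¬ Function.Surjective (θ.ppSel p (gOfRecord₁₀ F N θ.toStage9Params p) (j + 1)))
    (hnd : ∀ (s' : SeqOfRecord F θ.ν θ.τ9.M (gOfRecord₁₀ F N θ.toStage9Params p) p.K (j + 2))
      (t : Sect2.TermValues (F.P p.K) (MatA N) (FluctV N) θ.τ9.M) (Ek : ℝ),
      Sect2.LawsT (sect2TowerOfRecord F N (FluctV N) p.K (settingOfRecord₁₁ F N θ p) (θ.Rz p.K) s' t) (settingOfRecord₁₁ F N θ p).lf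
        (settingOfRecord₁₁ F N θ p).βc (j + 1) →
      ¬ ∀ᵐ V ∂(fieldMeasure (F.P p.K) (j + 2) (SU N)), chiSeqOfRecord F N θ.ν θ.τ9.M (gOfRecord₁₀ F N θ.toStage9Params p) p.K (j + 2) s' V ≠ 0 →
        sect2Slot F N (FluctV N) p.K (settingOfRecord₁₁ F N θ p) (θ.Rz p.K) (θ.Wt p.K) s' t Ek (UbgOfRecord₁₁ F N θ p (j + 2) s') V = 0) :
    TLaw₁₁ F N θ p (j + 1) → SLaw₁₁ F N θ p (j + 2) :=
  fun hT => absurd (surjective_ppSel_of_tLaw₁₁_succ F N θ p j hT hnd) hsel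

end CensusT

/-! ## §7 (v1.1)  THE 𝐑-STEP NEVER DECREASES A PRESENT SLOT ON ITS SUPPORT: on a fixed point `s′` of the selector the 𝐑-factor is `≥ 1` -/

section Monotone

variable {P : Params} {G : Type*} [GaugeGroup G] [MeasurableSpace G] [HaarData G] {j : ℕ}

/-- A fibre integral `∫dV⌈_{Z′} f` (b01's `fibreIntegral`: `toReal` of a lower integral of `ofReal ∘ f`) is non-negative, whatever `f`.
[cite: Balaban1989LargeFieldI, (0.3) p.176 (bookkeeping)] -/
theorem fibreIntegral_nonneg' {hP : DecidableEq (PBond P j)} (s : Finset (PBond P j)) (f : Density P j G) (V : GaugeField P j G) :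
    0 ≤ B15.BasicStep.fibreIntegral s f V := by
  unfold B15.BasicStep.fibreIntegral
  exact ENNReal.toReal_nonneg

open Classical in
/-- **ON A FIXED POINT OF THE SELECTOR THE 𝐑-STEPPED SLOT DOMINATES THE SLOT** (p. 176: «the densities are positive, and the integration domains … nonempty,
hence the denominators are positive», READ ON THE SUPPORT): with `sel a′ = a′` the 𝐑-factor is `∫⌈t_{a′}∕∫⌈t_{a′} + Σ_{a ≠ a′, sel a = a′} ∫⌈_{Z′(a)} t_a ∕ ∫⌈_{Z′(a)} t_{a′}
≥ 1` where the diagonal fibre integral is nonzero (every ratio is a quotient of non-negative fibre integrals), and both sides vanish where it is zero (support-form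
proviso + `χ(a′)(V) ≠ 0`); `0 ≤ t_{a′}(V)` and `0 ≤ χ(a′)(V)` make `(𝐓e^A)(a′)(V) ≥ 0`.  So `(𝐓e^A)(a′)(V) ≤ (𝐓e^A)′(a′)(V)`: absorbing the `Z′`-integrals of the
terms selected onto `a′` can only ADD mass to the term `a′`. [cite: Balaban1989LargeFieldI, (0.3) p.176] -/
theorem le_rstepOfSel_TexpA_of_sel_self {hP : DecidableEq (PBond P j)} (r : Step.Repr218 P G j) (sel : r.Adm → r.Adm)
    (fib : r.Adm → Finset (PBond P j)) (a' : r.Adm) (hfix : sel a' = a') (V : GaugeField P j G) (h0 : 0 ≤ rterm r a' V)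
    (hχ0 : 0 ≤ r.χ a' V) (hsupp : B15.BasicStep.fibreIntegral (fib a') (rterm r a') V = 0 → rterm r a' V = 0) (hχ : r.χ a' V ≠ 0) :
    r.TexpA a' V ≤ (rstepOfSel r sel fib).TexpA a' V := by
  rw [rstepOfSel_TexpA]
  have hmem : a' ∈ Finset.univ.filter (fun a => sel a = a') := by simp [hfix]
  have hT0 : 0 ≤ r.TexpA a' V :=
    (mul_nonneg_iff_of_pos_left (lt_of_le_of_ne hχ0 (Ne.symm hχ))).mp h0
  by_cases hFI : B15.BasicStep.fibreIntegral (fib a') (rterm r a') V = 0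
  · have hT : r.TexpA a' V = 0 := by
      rcases mul_eq_zero.1 (hsupp hFI) with h | h
      · exact absurd h hχ
      · exact h
    rw [hT, zero_mul]
  · have hsum : 1 ≤ ∑ a ∈ Finset.univ.filter (fun a => sel a = a'), rratio r fib a a' V := by
      rw [← Finset.add_sum_erase _ _ hmem]
      have h1 : rratio r fib a' a' V = 1 := by rw [rratio, div_self hFI]
      rw [h1]
      have hrest : 0 ≤ ∑ x ∈ (Finset.univ.filter (fun a => sel a = a')).erase a', rratio r fib x a' V :=
        Finset.sum_nonneg fun x _ => div_nonneg (fibreIntegral_nonneg' _ _ V) (fibreIntegral_nonneg' _ _ V)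
      linarith
    exact le_mul_of_one_le_right hT0 hsum

end Monotone

section MonotoneAtRecord

variable {F N} (ν : Stage7Numerics) (τ : TowerNumerics)

/-- `R` of record as a slot operation DOMINATES the slot at every fixed point of the selector, on the `χ_k(s′)`-support, given the pointwise provisos at `s′`
(non-negative piece, support form) — ARBITRARY slot family `f`. [cite: Balaban1989LargeFieldI, (0.3) p.176] -/
theorem le_rstepSlotOfRecord_of_sel_self (ppSel : PpSelOfRecord F ν τ.M) (p : B12.RunParams) (g : ℕ → ℝ) (k : ℕ)
    (f : TexpASlot F N ν τ.M p g k) (s' : SeqOfRecord F ν τ.M g p.K k) (hfix : ppSel p g k s' = s') (V : GaugeField (F.P p.K) k (SU N))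
    (h0 : 0 ≤ chiSeqOfRecord F N ν τ.M g p.K k s' V * f s' V)
    (hsupp : B15.BasicStep.fibreIntegral (fibOfSeq F ν τ p g k s')
        (fun U => chiSeqOfRecord F N ν τ.M g p.K k s' U * f s' U) V = 0 →
      chiSeqOfRecord F N ν τ.M g p.K k s' V * f s' V = 0)
    (hχ : chiSeqOfRecord F N ν τ.M g p.K k s' V ≠ 0) :
    f s' V ≤ rstepSlotOfRecord F N ν τ ppSel p g k f s' V := by
  unfold rstepSlotOfRecord rstepSlot
  refine le_rstepOfSel_TexpA_of_sel_self (sliceOfRecord F N ν τ.M p g k f) (ppSel p g k) (fibOfSeq F ν τ p g k) s' hfix V h0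
    (chi218_nonneg _ _ _ _ _ _ _ _ _) ?_ hχ
  intro hFI
  apply hsupp
  convert hFI using 2
  rfl

variable (F N) (θ : Stage11Params F N) (p : B12.RunParams)

/-- **AT THE STAGE-11 RECORD, ON EVERY FIXED POINT `s′` OF `θ.ppSel p g (k+1)` (every PRESENT sequence of an idempotent selector), THE POST-𝐑 SLOT OF `ρ_{k+1}`
DOMINATES THE PRE-𝐑 SLOT OF `𝐓ρ_k` ON THE `χ_{k+1}(s′)`-SUPPORT**: `slotT_{k+1}(s′)(V) ≤ slot_{k+1}(s′)(V)` — under the provisos (`Provisos₁₁.base.rstep`: pieces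
non-negative, denominators positive on the support).  The 𝐑-factor to be absorbed by [B16] Theorem 1 is `≥ 1` on the support (its logarithm — print's new boundary
terms summed — is `≥ 0` there); a lower bound proved for the 𝐓-image slot survives the 𝐑-step on present sequences. [cite: Balaban1989LargeFieldI, (0.3) p.176, Prop. 1 (1.2) p.177; Balaban1989LargeFieldII, Thm 1 p.355] -/
theorem slotsT_le_slots_succ_of_sel_self (h : θ.Provisos₁₁) (k : ℕ) (hk : k < p.K)
    (s' : SeqOfRecord F θ.ν θ.τ9.M (gOfRecord₁₀ F N θ.toStage9Params p) p.K (k + 1))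
    (hfix : θ.ppSel p (gOfRecord₁₀ F N θ.toStage9Params p) (k + 1) s' = s') (V : GaugeField (F.P p.K) (k + 1) (SU N))
    (hχ : chiSeqOfRecord F N θ.ν θ.τ9.M (gOfRecord₁₀ F N θ.toStage9Params p) p.K (k + 1) s' V ≠ 0) :
    slotsTOfRecord F N θ.ν θ.τ9 (EOfRecord₁₀ F N θ.toStage9Params) (wOfRecord₉ F N θ.toStage9Params) θ.ppSel p
        (gOfRecord₁₀ F N θ.toStage9Params p) (k + 1) s' V
      ≤ slotsOfRecord F N θ.ν θ.τ9 (EOfRecord₁₀ F N θ.toStage9Params) (wOfRecord₉ F N θ.toStage9Params) θ.ppSel p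
          (gOfRecord₁₀ F N θ.toStage9Params p) (k + 1) s' V := by
  rw [slotsOfRecord_succ]
  have HP := h.base.rstep p k hk
  have H0 := HP.2.1 s' V
  have Hs := HP.2.2.2 s' V
  change 0 ≤ rterm (repr218OfRecord F N θ.ν θ.τ9.M (slotsTOfRecord F N θ.ν θ.τ9 (EOfRecord₁₀ F N θ.toStage9Params)
      (wOfRecord₉ F N θ.toStage9Params) θ.ppSel) p (gOfRecord₁₀ F N θ.toStage9Params p) (k + 1)) s' V at H0
  change B15.BasicStep.fibreIntegral (fibOfSeq F θ.ν θ.τ9 p (gOfRecord₁₀ F N θ.toStage9Params p) (k + 1) s')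
      (rterm (repr218OfRecord F N θ.ν θ.τ9.M (slotsTOfRecord F N θ.ν θ.τ9 (EOfRecord₁₀ F N θ.toStage9Params)
        (wOfRecord₉ F N θ.toStage9Params) θ.ppSel) p (gOfRecord₁₀ F N θ.toStage9Params p) (k + 1))
        (θ.ppSel p (gOfRecord₁₀ F N θ.toStage9Params p) (k + 1) s')) V = 0 →
      rterm (repr218OfRecord F N θ.ν θ.τ9.M (slotsTOfRecord F N θ.ν θ.τ9 (EOfRecord₁₀ F N θ.toStage9Params)
        (wOfRecord₉ F N θ.toStage9Params) θ.ppSel) p (gOfRecord₁₀ F N θ.toStage9Params p) (k + 1)) s' V = 0 at Hs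
  rw [hfix] at Hs
  exact le_rstepSlotOfRecord_of_sel_self θ.ν θ.τ9 θ.ppSel p _ (k + 1) _ s' hfix V H0 Hs hχ

/-- **… IN PARTICULAR ON THE IDENTITY-SELECTOR BRANCH OF §3, OR FOR EVERY PRESENT SEQUENCE OF AN IDEMPOTENT SELECTOR** (`s′ = sel a ⇒ sel s′ = s′`).
[cite: Balaban1989LargeFieldI, (0.3) p.176, p.177] -/
theorem slotsT_le_slots_succ_of_mem_range_of_idem (h : θ.Provisos₁₁) (k : ℕ) (hk : k < p.K)
    (hidem : ∀ a, θ.ppSel p (gOfRecord₁₀ F N θ.toStage9Params p) (k + 1) (θ.ppSel p (gOfRecord₁₀ F N θ.toStage9Params p) (k + 1) a)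
      = θ.ppSel p (gOfRecord₁₀ F N θ.toStage9Params p) (k + 1) a)
    (s' : SeqOfRecord F θ.ν θ.τ9.M (gOfRecord₁₀ F N θ.toStage9Params p) p.K (k + 1))
    (hs' : s' ∈ Set.range (θ.ppSel p (gOfRecord₁₀ F N θ.toStage9Params p) (k + 1))) (V : GaugeField (F.P p.K) (k + 1) (SU N))
    (hχ : chiSeqOfRecord F N θ.ν θ.τ9.M (gOfRecord₁₀ F N θ.toStage9Params p) p.K (k + 1) s' V ≠ 0) :
    slotsTOfRecord F N θ.ν θ.τ9 (EOfRecord₁₀ F N θ.toStage9Params) (wOfRecord₉ F N θ.toStage9Params) θ.ppSel p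
        (gOfRecord₁₀ F N θ.toStage9Params p) (k + 1) s' V
      ≤ slotsOfRecord F N θ.ν θ.τ9 (EOfRecord₁₀ F N θ.toStage9Params) (wOfRecord₉ F N θ.toStage9Params) θ.ppSel p
          (gOfRecord₁₀ F N θ.toStage9Params p) (k + 1) s' V := by
  obtain ⟨a, rfl⟩ := hs'
  exact slotsT_le_slots_succ_of_sel_self F N θ p h k hk _ (hidem a) V hχ

end MonotoneAtRecord

end Literature.MathematicalPhysics.QuantumFieldTheory.Balaban1983to89.B16RLeafRecord11

end
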